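import Summits.PneNP.PneNP.Theorems.ChebyshevTracialDesignRungPieces
import HarnessLib

/-!
# Cell pnp-psdrank, route `ChebyshevTracialDesign`: the NON-CROSSING CELLS of the `r = 1` rung carry an EXACT DESIGN of the reduced instance —
# the level-class ratio `|Q''_c|/|Q_c|` is a polynomial of degree `|S|` in the level `c`

Harmonic backbone of the crux `TracialDecayExp20` (stmt-PneNP-19878), brick 48 (prover g10; input of NTF mod KL — the non-tight-free `r = 1`
rung). In brick 30 (`…RungCells.noncrossing_cell_eq`) the value of a non-crossing cell `A_π × B` (core `S` a perfect matching of `V`,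
`|V| = 2s`, pattern `π ⊆ V` with `crossCount π S = 0`, `|π| = 2p₁`, all `M ∈ B` containing `S`) is `Σ_c w_c·(|Q''_c(t−|π|)|/|Q_c(t)|)·μ''_c(Ã × B̃)`
with `μ''` Rothvoß's measures of the reduced rectangle in `K_m`, `m = n − |V|`. In the tight-free rung these cells are junk (SNT). Here:
* §1 `levelCount_mul_descFactorial_eq` — the multinomial identity behind `|Q_c| = |PM|·C(N, (t+c)/2)·C((t+c)/2, (t−c)/2)·2^c`
  (`…LevelNormalisation.card_Qset_eq`): `T(N−s; k−p₁, i−p₁)·[N]_s = T(N; k, i)·[N−k]_{s−p₁}·[i]_{p₁}`, `T(N;k,i) = C(N,k)C(k,i)`;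
* §2 **`cellRatio_eq_eval`** — hence `|Q''_c(m, t−2p₁)| = ρ_π(c)·|Q_c(n,t)|` for every odd `c ≤ t − 2p₁` with `(t−2p₁) + c ≤ m`, where
  `ρ_π(X) = κ₀ · Π_{j<s−p₁} ((n−t−X)/2 − j) · Π_{j<p₁} ((t−X)/2 − j)`, `κ₀ = (|PM_m|/|PM_n|)/[n/2]_s`, is a real POLYNOMIAL of degree `≤ s`
  (`natDegree_cellRatio_le`), positive and non-increasing on `[0, t − 2p₁]` (`cellRatio_eval_pos`, `cellRatio_eval_le_eval_zero`), with
  `ρ_π(0) ≤ 2·|PM_m|/|PM_n| = 2·ν(⟨S⟩)` once `2s² + s ≤ n/2` (`cellRatio_eval_zero_le`);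
* §3 **`reducedDesign_exact`**, `reducedDesign_variation_le` — the REDUCED DESIGN `w'_c = w_c·ρ_π(c)/ρ_π(0)` is exact of degree `D − s` at the
  virtual level (`Σ_c w'_c q(c) = −q(0)` for `deg q ≤ D − s`, from the exactness of `w` at degree `D` applied to `ρ_π·q`) with `Σ|w'_c| ≤ Σ|w_c|`;
* §4 **`noncrossing_cell_eq_reduced_value`** — `Σ_{A_π × B} W = ρ_π(0) · Σ_{Ã × B̃} W'` with `W' = levelWeight m (t−2p₁) C w'`: a non-crossing cell
  of the `r = 1` rung IS, up to the factor `ρ_π(0) ≤ 2ν(⟨S⟩)`, a rectangle of the reduced instance evaluated against an exact design of degree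
  `D − s` and the same variation — so brick 46/47's spread-cell bound applies to it (next file);
[cite: Rothvoss2017, §2 (PDF p. 6)] [cite: KupavskiiZakharov2022, §2 and Lemma 11] [cite: Grigoriev2001, Lemma 1.4 (PDF p. 8)]
Stature: support/instrument (no defs). WHAT THIS IS NOT: not NTF, nothing on psd rank, no P-vs-NP content. Supports stmt-PneNP-19878.
-/

set_option linter.dupNamespace false -- `Summit.PneNP.PneNP.…`: summit = sub-problem (D-0017)

noncomputable section

namespace Summit.PneNP.PneNP.Theorems.ChebyshevTracialDesignNonCrossingCellDesign

open Finset Polynomial Literature.Combinatorics.Optimization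
open Literature.Barriers.PneNP hiding verts
open Literature.Combinatorics.SetFamily
open Literature.Combinatorics.SimpleGraph.CycleSpace
open Literature.Combinatorics.AssociationSchemes.CutMatchingRestriction
open Summit.PneNP.PneNP.Theorems.ChebyshevTracialDesignProfilePolynomial (card_pmatch_pos)
open Summit.PneNP.PneNP.Theorems.ChebyshevTracialDesignLevelNormalisation (card_Qset_eq)
open Summit.PneNP.PneNP.Theorems.ChebyshevTracialDesignRungCells
open Summit.PneNP.PneNP.Theorems.ChebyshevTracialDesignRungPieces
open Summit.PneNP.PneNP.Theorems.ChebyshevTracialDesignJunta (cast_descFactorial_eq_prod)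

variable {n : ℕ}

/-! ### §1 The multinomial identity behind the level-class sizes -/

/-- `C(N,k)·C(k,i)·i!·(k−i)!·(N−k)! = N!` (`i ≤ k ≤ N`). [folklore] -/
theorem levelCount_mul_factorials {N k i : ℕ} (hik : i ≤ k) (hkN : k ≤ N) :
    N.choose k * k.choose i * i.factorial * (k - i).factorial * (N - k).factorial = N.factorial := by
  have h1 := Nat.choose_mul_factorial_mul_factorial hkN
  have h2 := Nat.choose_mul_factorial_mul_factorial hik
  calc N.choose k * k.choose i * i.factorial * (k - i).factorial * (N - k).factorial
      = N.choose k * (k.choose i * i.factorial * (k - i).factorial) * (N - k).factorial := by ring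
    _ = N.factorial := by rw [h2, h1]

/-- **The reduced level-class count against the full one**: for `p₁ ≤ i`, `p₂ + k ≤ N + p₁`... precisely with `s = p₁ + p₂`, `i ≤ k`,
`k ≤ N`, `p₁ ≤ i`, `p₂ ≤ N − k`:
`C(N−s, k−p₁)·C(k−p₁, i−p₁)·[N]_s = C(N,k)·C(k,i)·[N−k]_{p₂}·[i]_{p₁}` (`[x]_p` the falling factorial `descFactorial`). [folklore] -/
theorem levelCount_mul_descFactorial_eq {N k i p₁ p₂ : ℕ} (hik : i ≤ k) (hkN : k ≤ N) (hp₁ : p₁ ≤ i) (hp₂ : p₂ ≤ N - k) :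
    (N - (p₁ + p₂)).choose (k - p₁) * (k - p₁).choose (i - p₁) * N.descFactorial (p₁ + p₂) =
      N.choose k * k.choose i * (N - k).descFactorial p₂ * i.descFactorial p₁ := by
  -- multiply both sides by `(i−p₁)!·(k−i)!·(N−k−p₂)!` and compare with `N!`
  have hpos : 0 < (i - p₁).factorial * (k - i).factorial * (N - k - p₂).factorial := by positivity
  apply Nat.eq_of_mul_eq_mul_right hpos
  have hs : p₁ + p₂ ≤ N := by omega
  -- left side
  have hL : (N - (p₁ + p₂)).choose (k - p₁) * (k - p₁).choose (i - p₁) * N.descFactorial (p₁ + p₂) *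
      ((i - p₁).factorial * (k - i).factorial * (N - k - p₂).factorial) = N.factorial := by
    have h1 := levelCount_mul_factorials (N := N - (p₁ + p₂)) (k := k - p₁) (i := i - p₁) (by omega) (by omega)
    have e1 : k - p₁ - (i - p₁) = k - i := by omega
    have e2 : N - (p₁ + p₂) - (k - p₁) = N - k - p₂ := by omega
    rw [e1, e2] at h1
    have h3 := Nat.factorial_mul_descFactorial hs
    calc (N - (p₁ + p₂)).choose (k - p₁) * (k - p₁).choose (i - p₁) * N.descFactorial (p₁ + p₂) *
          ((i - p₁).factorial * (k - i).factorial * (N - k - p₂).factorial)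
        = ((N - (p₁ + p₂)).choose (k - p₁) * (k - p₁).choose (i - p₁) * (i - p₁).factorial * (k - i).factorial *
            (N - k - p₂).factorial) * N.descFactorial (p₁ + p₂) := by ring
      _ = N.factorial := by rw [h1, h3]
  -- right side
  have hR : N.choose k * k.choose i * (N - k).descFactorial p₂ * i.descFactorial p₁ *
      ((i - p₁).factorial * (k - i).factorial * (N - k - p₂).factorial) = N.factorial := by
    have h1 := levelCount_mul_factorials hik hkN
    have h2 := Nat.factorial_mul_descFactorial hp₁
    have h3 := Nat.factorial_mul_descFactorial hp₂
    calc N.choose k * k.choose i * (N - k).descFactorial p₂ * i.descFactorial p₁ *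
          ((i - p₁).factorial * (k - i).factorial * (N - k - p₂).factorial)
        = N.choose k * k.choose i * ((i - p₁).factorial * i.descFactorial p₁) * (k - i).factorial *
            ((N - k - p₂).factorial * (N - k).descFactorial p₂) := by ring
      _ = N.factorial := by rw [h2, h3, h1]
  rw [hL, hR]

/-! ### §2 The class-ratio polynomial -/

/-- **The class ratio is a polynomial of the level.** Let `n, m, s, p₁, c', m₁ : ℕ` with `n` even, `m + 2s = n`, `p₁ ≤ s`, `t = 2c'+1`,
`c = 2m₁+1 ≤ t − 2p₁` (i.e. `m₁ + p₁ ≤ c'`) and `(t − 2p₁) + c ≤ m`. With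
`ρ(X) = κ₀·Π_{j<s−p₁}(((n:ℝ)−t−X)/2 − j)·Π_{j<p₁}(((t:ℝ)−X)/2 − j)`, `κ₀ = (|PM_m|/|PM_n|)/Π_{j<s}(n/2 − j)`:
`|Q_c(m, t−2p₁)| = ρ(c)·|Q_c(n,t)|`. [cite: Rothvoss2017, §2 (PDF p. 6)] -/
theorem cellRatio_eq_eval {m s p₁ c' m₁ : ℕ} (hn : Even n) (hms : m + 2 * s = n) (hp₁ : p₁ ≤ s) (hc : m₁ + p₁ ≤ c')
    (hcm : (2 * (c' - p₁) + 1) + (2 * m₁ + 1) ≤ m) :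
    ((Qset m (2 * (c' - p₁) + 1) (2 * m₁ + 1)).card : ℝ) =
      (C (((Fintype.card (PMatch m) : ℝ) / Fintype.card (PMatch n)) / ∏ j ∈ range s, (((n / 2 : ℕ) : ℝ) - j)) *
          (∏ j ∈ range (s - p₁), (C ((((n : ℝ) - (2 * c' + 1 : ℕ)) / 2) - j) - C (1 / 2 : ℝ) * X)) *
          ∏ j ∈ range p₁, (C ((((2 * c' + 1 : ℕ) : ℝ)) / 2 - j) - C (1 / 2 : ℝ) * X)).eval (((2 * m₁ + 1 : ℕ) : ℝ)) *
        ((Qset n (2 * c' + 1) (2 * m₁ + 1)).card : ℝ) := by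
  obtain ⟨N, hN⟩ := hn
  have hN2 : n / 2 = N := by omega
  have hm2 : m / 2 = N - s := by omega
  have hPMn : (0 : ℝ) < Fintype.card (PMatch n) := by exact_mod_cast card_pmatch_pos ⟨N, hN⟩
  -- the two class sizes
  have hQn := card_Qset_eq (n := n) (c' := c') (m := m₁) (by omega)
  have hQm := card_Qset_eq (n := m) (c' := c' - p₁) (m := m₁) (by omega)
  rw [hN2] at hQn
  rw [hm2] at hQm
  -- indices: `k = m₁+1+c'`, `i = c' − m₁`, reduced `k − p₁`, `i − p₁`
  set k := 2 * m₁ + 1 + (c' - m₁) with hk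
  set i := c' - m₁ with hi
  have ek : 2 * m₁ + 1 + (c' - p₁ - m₁) = k - p₁ := by omega
  have ei : c' - p₁ - m₁ = i - p₁ := by omega
  rw [ek, ei] at hQm
  -- the ℕ identity
  have hkN : k ≤ N := by omega
  have hik : i ≤ k := by omega
  have hp₁i : p₁ ≤ i := by omega
  have hp₂ : s - p₁ ≤ N - k := by omega
  have hid := levelCount_mul_descFactorial_eq (N := N) (k := k) (i := i) (p₁ := p₁) (p₂ := s - p₁) hik hkN hp₁i hp₂
  rw [show p₁ + (s - p₁) = s by omega] at hid
  have hidR : (((N - s).choose (k - p₁) : ℕ) : ℝ) * ((k - p₁).choose (i - p₁) : ℕ) * (N.descFactorial s : ℕ) =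
      (N.choose k : ℕ) * (k.choose i : ℕ) * ((N - k).descFactorial (s - p₁) : ℕ) * (i.descFactorial p₁ : ℕ) := by
    exact_mod_cast hid
  -- evaluate the polynomial
  have hevalA : ∀ (a : ℝ) (p : ℕ) (x : ℝ), (∏ j ∈ range p, (C (a - j) - C (1 / 2 : ℝ) * X)).eval x = ∏ j ∈ range p, (a - x / 2 - j) := by
    intro a p x
    rw [eval_prod]
    refine prod_congr rfl fun j _ => ?_
    simp only [eval_sub, eval_C, eval_mul, eval_X]
    ring
  rw [eval_mul, eval_mul, eval_C, hevalA, hevalA]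
  -- the falling factorials as the real products at `x = c`
  have hdescN : ((N.descFactorial s : ℕ) : ℝ) = ∏ j ∈ range s, ((N : ℝ) - j) := cast_descFactorial_eq_prod (by omega)
  have hdesc1 : ((i.descFactorial p₁ : ℕ) : ℝ) =
      ∏ j ∈ range p₁, ((((2 * c' + 1 : ℕ) : ℝ)) / 2 - (((2 * m₁ + 1 : ℕ) : ℝ)) / 2 - j) := by
    rw [cast_descFactorial_eq_prod hp₁i]
    refine prod_congr rfl fun j _ => ?_
    rw [hi, Nat.cast_sub (by omega)]
    push_cast
    ring
  have hdesc2 : (((N - k).descFactorial (s - p₁) : ℕ) : ℝ) =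
      ∏ j ∈ range (s - p₁), (((n : ℝ) - (2 * c' + 1 : ℕ)) / 2 - (((2 * m₁ + 1 : ℕ) : ℝ)) / 2 - j) := by
    rw [cast_descFactorial_eq_prod hp₂]
    refine prod_congr rfl fun j _ => ?_
    rw [Nat.cast_sub hkN, hk]
    have : (n : ℝ) = N + N := by exact_mod_cast hN
    push_cast
    rw [this, Nat.cast_sub (by omega : m₁ ≤ c')]
    ring
  have hprodN : (∏ j ∈ range s, ((N : ℝ) - j)) ≠ 0 := by
    refine prod_ne_zero_iff.2 fun j hj => ?_
    have := mem_range.1 hj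
    have : (j : ℝ) < N := by exact_mod_cast (show j < N by omega)
    linarith
  rw [hQn, hQm, ← hdesc1, ← hdesc2, hN2, ← hdescN]
  -- now pure algebra with the ℕ identity
  have hT : ((N.choose k : ℕ) : ℝ) * (k.choose i : ℕ) ≠ 0 := by
    have h1 : 0 < N.choose k := Nat.choose_pos hkN
    have h2 : 0 < k.choose i := Nat.choose_pos hik
    positivity
  have hdpos : ((N.descFactorial s : ℕ) : ℝ) ≠ 0 := by rw [hdescN]; exact hprodN
  field_simp
  push_cast
  linear_combination ((Fintype.card (PMatch m) : ℝ)) * (2 : ℝ) ^ (2 * m₁ + 1) * hidR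

/-- A linear factor `C a − C(1/2)·X` has degree `≤ 1`. [folklore] -/
theorem natDegree_linFactor_le (a : ℝ) : (C a - C (1 / 2 : ℝ) * X : Polynomial ℝ).natDegree ≤ 1 :=
  (natDegree_sub_le _ _).trans (max_le (by simp) ((natDegree_C_mul_le _ _).trans natDegree_X_le))

/-- **The class-ratio polynomial has degree `≤ s`.** [folklore] -/
theorem natDegree_cellRatio_le (κ₀ a b : ℝ) (s p₁ : ℕ) (hp₁ : p₁ ≤ s) :
    (C κ₀ * (∏ j ∈ range (s - p₁), (C (a - j) - C (1 / 2 : ℝ) * X)) *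
        ∏ j ∈ range p₁, (C (b - j) - C (1 / 2 : ℝ) * X)).natDegree ≤ s := by
  have h1 : (∏ j ∈ range (s - p₁), (C (a - j) - C (1 / 2 : ℝ) * X)).natDegree ≤ s - p₁ := by
    refine (natDegree_prod_le _ _).trans ?_
    calc ∑ j ∈ range (s - p₁), (C (a - (j : ℝ)) - C (1 / 2 : ℝ) * X).natDegree ≤ ∑ _j ∈ range (s - p₁), 1 :=
          sum_le_sum (f := fun j : ℕ => (C (a - (j : ℝ)) - C (1 / 2 : ℝ) * X).natDegree) (g := fun _ => 1)
            fun j _ => natDegree_linFactor_le _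
      _ = s - p₁ := by simp
  have h2 : (∏ j ∈ range p₁, (C (b - j) - C (1 / 2 : ℝ) * X)).natDegree ≤ p₁ := by
    refine (natDegree_prod_le _ _).trans ?_
    calc ∑ j ∈ range p₁, (C (b - (j : ℝ)) - C (1 / 2 : ℝ) * X).natDegree ≤ ∑ _j ∈ range p₁, 1 :=
          sum_le_sum (f := fun j : ℕ => (C (b - (j : ℝ)) - C (1 / 2 : ℝ) * X).natDegree) (g := fun _ => 1)
            fun j _ => natDegree_linFactor_le _
      _ = p₁ := by simp
  calc _ ≤ (C κ₀ * ∏ j ∈ range (s - p₁), (C (a - j) - C (1 / 2 : ℝ) * X)).natDegree +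
        (∏ j ∈ range p₁, (C (b - j) - C (1 / 2 : ℝ) * X)).natDegree := natDegree_mul_le
    _ ≤ (s - p₁) + p₁ := add_le_add ((natDegree_C_mul_le _ _).trans h1) h2
    _ = s := by omega

/-- **Evaluation of the class-ratio polynomial**: `ρ(x) = κ₀·Π_{j<s−p₁}(a − x/2 − j)·Π_{j<p₁}(b − x/2 − j)`. [folklore] -/
theorem eval_cellRatio (κ₀ a b : ℝ) (s p₁ : ℕ) (x : ℝ) :
    (C κ₀ * (∏ j ∈ range (s - p₁), (C (a - j) - C (1 / 2 : ℝ) * X)) *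
        ∏ j ∈ range p₁, (C (b - j) - C (1 / 2 : ℝ) * X)).eval x =
      κ₀ * (∏ j ∈ range (s - p₁), (a - x / 2 - j)) * ∏ j ∈ range p₁, (b - x / 2 - j) := by
  have hevalA : ∀ (a : ℝ) (p : ℕ), (∏ j ∈ range p, (C (a - j) - C (1 / 2 : ℝ) * X)).eval x = ∏ j ∈ range p, (a - x / 2 - j) := by
    intro a p
    rw [eval_prod]
    refine prod_congr rfl fun j _ => ?_
    simp only [eval_sub, eval_C, eval_mul, eval_X]
    ring
  rw [eval_mul, eval_mul, eval_C, hevalA, hevalA]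

/-- **Positivity and monotonicity of the class ratio**: for `0 ≤ x` with `x/2 + p₁ ≤ b + 1/2` and `x/2 + (s − p₁) ≤ a + 1/2` (all factors
positive) and `κ₀ > 0`: `0 < ρ(x) ≤ ρ(0)`. [folklore] -/
theorem cellRatio_eval_pos_le {κ₀ a b : ℝ} {s p₁ : ℕ} (hκ₀ : 0 < κ₀) {x : ℝ} (hx : 0 ≤ x)
    (hxa : x / 2 + ((s - p₁ : ℕ) : ℝ) < a + 1) (hxb : x / 2 + (p₁ : ℝ) < b + 1) :
    0 < κ₀ * (∏ j ∈ range (s - p₁), (a - x / 2 - j)) * ∏ j ∈ range p₁, (b - x / 2 - j) ∧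
      κ₀ * (∏ j ∈ range (s - p₁), (a - x / 2 - j)) * ∏ j ∈ range p₁, (b - x / 2 - j) ≤
        κ₀ * (∏ j ∈ range (s - p₁), (a - 0 / 2 - j)) * ∏ j ∈ range p₁, (b - 0 / 2 - j) := by
  have hfa : ∀ j ∈ range (s - p₁), 0 < a - x / 2 - j := by
    intro j hj
    have := mem_range.1 hj
    have : (j : ℝ) + 1 ≤ ((s - p₁ : ℕ) : ℝ) := by exact_mod_cast this
    linarith
  have hfb : ∀ j ∈ range p₁, 0 < b - x / 2 - j := by
    intro j hj
    have := mem_range.1 hj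
    have : (j : ℝ) + 1 ≤ (p₁ : ℝ) := by exact_mod_cast this
    linarith
  refine ⟨mul_pos (mul_pos hκ₀ (prod_pos hfa)) (prod_pos hfb), ?_⟩
  refine mul_le_mul (mul_le_mul_of_nonneg_left ?_ hκ₀.le) ?_ (prod_pos hfb).le
    (mul_nonneg hκ₀.le (prod_nonneg fun j hj => ?_))
  · exact prod_le_prod (fun j hj => (hfa j hj).le) fun j _ => by linarith
  · exact prod_le_prod (fun j hj => (hfb j hj).le) fun j _ => by linarith
  · have := hfa j hj; linarith

/-- `(1 + y)^s ≤ 1 + 2sy` for `y ≥ 0` and `2sy ≤ 1`. [folklore] -/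
theorem one_add_pow_le_of_small {y : ℝ} (hy : 0 ≤ y) : ∀ s : ℕ, 2 * s * y ≤ 1 → (1 + y) ^ s ≤ 1 + 2 * s * y
  | 0, _ => by simp
  | s + 1, h => by
    have hs : 2 * (s : ℝ) * y ≤ 1 := by push_cast at h; nlinarith
    have ih := one_add_pow_le_of_small hy s hs
    rw [pow_succ]
    calc (1 + y) ^ s * (1 + y) ≤ (1 + 2 * s * y) * (1 + y) := mul_le_mul_of_nonneg_right ih (by linarith)
      _ = 1 + 2 * s * y + y + (2 * s * y) * y := by ring
      _ ≤ 1 + 2 * s * y + y + 1 * y := by nlinarith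
      _ = 1 + 2 * ((s + 1 : ℕ) : ℝ) * y := by push_cast; ring

/-- **The class ratio at the virtual level is at most twice the star density**: with `N = n/2`, `2s² + s ≤ N`, `a, b ≤ N`:
`(1/Π_{j<s}(N−j))·Π_{j<s−p₁}(a − j)·Π_{j<p₁}(b − j) ≤ 2`, hence `ρ(0) ≤ 2·|PM_m|/|PM_n|`. [folklore] -/
theorem cellRatio_zero_core_le {N s p₁ : ℕ} {a b : ℝ} (hp₁ : p₁ ≤ s) (hs : 2 * s * s + s ≤ N) (ha : a ≤ N) (hb : b ≤ N)
    (ha0 : ∀ j ∈ range (s - p₁), 0 ≤ a - j) (hb0 : ∀ j ∈ range p₁, 0 ≤ b - j) :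
    (∏ j ∈ range (s - p₁), (a - 0 / 2 - j)) * ∏ j ∈ range p₁, (b - 0 / 2 - j) ≤ 2 * ∏ j ∈ range s, ((N : ℝ) - j) := by
  -- numerator ≤ N^s
  have hnum : (∏ j ∈ range (s - p₁), (a - 0 / 2 - j)) * ∏ j ∈ range p₁, (b - 0 / 2 - j) ≤ (N : ℝ) ^ s := by
    have h1 : ∏ j ∈ range (s - p₁), (a - 0 / 2 - j) ≤ ∏ _j ∈ range (s - p₁), (N : ℝ) :=
      prod_le_prod (fun j hj => by have := ha0 j hj; linarith) fun j hj => by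
        have : (0 : ℝ) ≤ j := Nat.cast_nonneg j; linarith
    have h2 : ∏ j ∈ range p₁, (b - 0 / 2 - j) ≤ ∏ _j ∈ range p₁, (N : ℝ) :=
      prod_le_prod (fun j hj => by have := hb0 j hj; linarith) fun j hj => by
        have : (0 : ℝ) ≤ j := Nat.cast_nonneg j; linarith
    rw [prod_const, card_range] at h1 h2
    calc _ ≤ (N : ℝ) ^ (s - p₁) * (N : ℝ) ^ p₁ :=
          mul_le_mul h1 h2 (prod_nonneg fun j hj => by have := hb0 j hj; linarith) (by positivity)
      _ = (N : ℝ) ^ s := by rw [← pow_add, Nat.sub_add_cancel hp₁]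
  -- denominator ≥ (N − s)^s and `N^s ≤ 2 (N−s)^s`
  have hNs : (s : ℝ) ≤ N := by exact_mod_cast (show s ≤ N by nlinarith)
  have hden : ((N : ℝ) - s) ^ s ≤ ∏ j ∈ range s, ((N : ℝ) - j) := by
    rw [← card_range s, ← prod_const, card_range]
    refine prod_le_prod (fun _ _ => by linarith) fun j hj => ?_
    have := mem_range.1 hj
    have : (j : ℝ) ≤ s := by exact_mod_cast this.le
    linarith
  rcases Nat.eq_zero_or_pos s with rfl | hspos
  · have hp0 : p₁ = 0 := by omega
    subst hp0
    simp
  have hNs' : (0 : ℝ) < (N : ℝ) - s := by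
    have : s < N := by nlinarith
    have : (s : ℝ) < N := by exact_mod_cast this
    linarith
  -- `(N/(N−s))^s ≤ 2`
  have hy : 0 ≤ (s : ℝ) / ((N : ℝ) - s) := by positivity
  have hsmall : 2 * s * ((s : ℝ) / ((N : ℝ) - s)) ≤ 1 := by
    rw [show 2 * (s : ℝ) * ((s : ℝ) / ((N : ℝ) - s)) = (2 * s * s) / ((N : ℝ) - s) by ring, div_le_one hNs']
    have : (2 * s * s + s : ℝ) ≤ N := by exact_mod_cast hs
    linarith
  have hpow := one_add_pow_le_of_small hy s hsmall
  have hratio : (N : ℝ) ^ s ≤ 2 * ((N : ℝ) - s) ^ s := by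
    have heq : (N : ℝ) ^ s = ((N : ℝ) - s) ^ s * (1 + (s : ℝ) / ((N : ℝ) - s)) ^ s := by
      rw [← mul_pow]; congr 1; field_simp; ring
    have h2 : (1 + (s : ℝ) / ((N : ℝ) - s)) ^ s ≤ 2 := hpow.trans (by linarith)
    calc (N : ℝ) ^ s = ((N : ℝ) - s) ^ s * (1 + (s : ℝ) / ((N : ℝ) - s)) ^ s := heq
      _ ≤ ((N : ℝ) - s) ^ s * 2 := mul_le_mul_of_nonneg_left h2 (by positivity)
      _ = 2 * ((N : ℝ) - s) ^ s := by ring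
  calc _ ≤ (N : ℝ) ^ s := hnum
    _ ≤ 2 * ((N : ℝ) - s) ^ s := hratio
    _ ≤ 2 * ∏ j ∈ range s, ((N : ℝ) - j) := by linarith

/-! ### §3 The reduced design -/

/-- **Exactness of the reduced design.** If `Σ_c w_c q(c) = −q(0)` for all `q` of degree `≤ D`, `ρ` is a polynomial of degree `≤ s ≤ D` with
`ρ(0) ≠ 0`, then `w'_c = w_c ρ(c)/ρ(0)` satisfies `Σ_c w'_c q(c) = −q(0)` for all `q` of degree `≤ D − s`. [cite: Rothvoss2017, §2 (PDF p. 6)] -/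
theorem reducedDesign_exact {D s : ℕ} {C' : Finset ℕ} {w : ℕ → ℝ} (hsD : s ≤ D)
    (hexact : ∀ q : Polynomial ℝ, q.natDegree ≤ D → ∑ c ∈ C', w c * q.eval (c : ℝ) = -q.eval 0)
    (ρ : Polynomial ℝ) (hρ : ρ.natDegree ≤ s) (hρ0 : ρ.eval 0 ≠ 0) :
    ∀ q : Polynomial ℝ, q.natDegree ≤ D - s →
      ∑ c ∈ C', (w c * ρ.eval (c : ℝ) / ρ.eval 0) * q.eval (c : ℝ) = -q.eval 0 := by
  intro q hq
  have hdeg : (ρ * q).natDegree ≤ D := natDegree_mul_le.trans (by omega)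
  have h := hexact (ρ * q) hdeg
  simp only [eval_mul] at h
  have : ∑ c ∈ C', (w c * ρ.eval (c : ℝ) / ρ.eval 0) * q.eval (c : ℝ) =
      (∑ c ∈ C', w c * (ρ.eval (c : ℝ) * q.eval (c : ℝ))) / ρ.eval 0 := by
    rw [sum_div]
    exact sum_congr rfl fun c _ => by field_simp
  rw [this, h]
  field_simp

/-- **Variation of the reduced design**: if `0 ≤ ρ(c) ≤ ρ(0)` on the levels and `ρ(0) > 0` then `Σ|w'_c| ≤ Σ|w_c|`. [folklore] -/
theorem reducedDesign_variation_le {C' : Finset ℕ} {w : ℕ → ℝ} (ρ : Polynomial ℝ) (hρ0 : 0 < ρ.eval 0)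
    (hρ : ∀ c ∈ C', 0 ≤ ρ.eval (c : ℝ) ∧ ρ.eval (c : ℝ) ≤ ρ.eval 0) :
    ∑ c ∈ C', |w c * ρ.eval (c : ℝ) / ρ.eval 0| ≤ ∑ c ∈ C', |w c| := by
  refine sum_le_sum fun c hc => ?_
  obtain ⟨h0, h1⟩ := hρ c hc
  rw [abs_div, abs_mul, abs_of_nonneg h0, abs_of_pos hρ0, div_le_iff₀ hρ0]
  exact mul_le_mul_of_nonneg_left h1 (abs_nonneg _)

/-! ### §4 The value of a non-crossing cell is `ρ(0)` times a reduced rectangle value against the reduced design -/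

/-- **Non-crossing cell = `ρ(0)` × reduced rectangle against the reduced design.** In the setting of `…RungCells.noncrossing_cell_eq`
(core `S` a perfect matching of `V`, pattern `π ⊆ V` with `crossCount π S = 0`, `|univ ∖ V| = m`, all `M ∈ B` containing `S`), if a real
polynomial `ρ` satisfies `|Q''_c(m, t − |π|)| = ρ(c)·|Q_c(n,t)|` and `Q_c(n,t) ≠ ∅` for every `c ∈ C`, and `ρ(0) ≠ 0`, then
`Σ_{U∈A, U∩V=π} Σ_{M∈B} W(U,M) = ρ(0) · Σ_{Ũ∈Ã} Σ_{M̃∈B̃} levelWeight m (t−|π|) C w' Ũ M̃` with `w'_c = w_c ρ(c)/ρ(0)`.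
[cite: Rothvoss2017, §2 (PDF p. 6)] -/
theorem noncrossing_cell_eq_reduced_value {m t : ℕ} (C' : Finset ℕ) (w : ℕ → ℝ) {V π : Finset (Fin n)} {S : Finset (Sym2 (Fin n))}
    (hS : IsPMOn V S) (hπ0 : crossCount π S = 0) (hπV : π ⊆ V) (hp : π.card ≤ t) (h : (univ \ V).card = m)
    (A : Finset (OddSet n)) (B : Finset (PMatch n)) (hB : ∀ M ∈ B, S ⊆ M.1) (ρ : Polynomial ℝ) (hρ0 : ρ.eval 0 ≠ 0)
    (hρ : ∀ c ∈ C', ((Qset m (t - π.card) c).card : ℝ) = ρ.eval (c : ℝ) * (Qset n t c).card)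
    (hQ : ∀ c ∈ C', (Qset n t c).Nonempty) :
    ∑ U ∈ A.filter (fun U => U.1 ∩ V = π), ∑ M ∈ B, levelWeight n t C' w U M =
      ρ.eval 0 * ∑ U ∈ oddCellCuts A V π h, ∑ M ∈ pmCellMatchings B V S h,
        levelWeight m (t - π.card) C' (fun c => w c * ρ.eval (c : ℝ) / ρ.eval 0) U M := by
  rw [noncrossing_cell_eq C' w hS hπ0 hπV hp h A B hB, sum_sum_levelWeight_eq_sum_mu, mul_sum]
  refine sum_congr rfl fun c hc => ?_
  have hQpos : (0 : ℝ) < (Qset n t c).card := by exact_mod_cast card_pos.2 (hQ c hc)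
  rw [hρ c hc, mul_div_cancel_right₀ _ hQpos.ne']
  field_simp

end Summit.PneNP.PneNP.Theorems.ChebyshevTracialDesignNonCrossingCellDesign
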